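import Literature.AlgebraicGeometry.HodgeTheory.LocallyTrivialExtensionClasses
import HarnessLib

/-!
# Local kernels in `H¹` of a monodromy group: one view point suffices on path-connected pieces

Topic `Literature/AlgebraicGeometry/HodgeTheory`; complements `LocallyTrivialExtensionClasses` (the
vocabulary of C. Schnell, *Primitive cohomology and the tube mapping*, Math. Z. 268 (2010) §3, §9 and
of P. Brosnan, H. Fang, Z. Nie, G. Pearlstein, *Singularities of admissible normal functions*,
Invent. Math. 177 (2009) §1) by proving the remark left open there ("when `ι⁻¹ N` is path connected
all these local subgroups are conjugate, so by `H1resKer_conj_smul` one pair suffices — not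
formalised here"), which is what identifies the tree's `localKernelOn ι V s N` /
`localKernel ι V s t₀` (all view points `s'`, all paths `γ`) with the kernel of restriction to ONE
local fundamental group `G_{t₀} = im (π₁(B ∖ Δ, s') → π₁(P ∖ Δ, s))` of the routes
LinearSystemTorelli / NodalSupport (items `DiscriminantDictionary`, `LocalTubeSpan`):

* `fundamentalGroupMulEquivOfPath_fromPath`, `conj_fromPath` — the change-of-base-point
  isomorphism and inner automorphisms on classes of loops (`β_h[f] = [h̄ · f · h]`,
  Hatcher Prop. 1.5), by `rfl`;
* `loopSubgroup_map_fundamentalGroupMulEquivOfPath` — transporting along a path `δ` INSIDE `W`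
  carries the loops-in-`W` subgroup at `x` onto the one at `y`;
* `localSubgroup_eq_conj_smul` — two local subgroups at the same piece `N`, seen from view points
  joined inside `ι⁻¹ N`, are conjugate in `π₁(S, s)` (explicit conjugator);
* `H1resKer_localSubgroup_eq_of_joinedIn`, `localKernelOn_eq_H1resKer` — hence their restriction
  kernels agree, and for path-connected `ι⁻¹ N` the local kernel at `N` is the restriction kernel of
  any one local subgroup;
* `mem_localKernel_iff_of_hasBasis` — the local kernel at `t₀` computed on any neighbourhood basis
  (e.g. small balls: BFNP's `colim_{B ∋ p} H¹(B ∩ U, 𝕍)`), and `localKernel_eq_of_forall_eq` — when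
  the kernels along the basis are constant (Milnor's conic structure) the local kernel is that
  common value;
* `map_eq_zero_iff_mem_H1resKer_range` — **inflation is injective in degree one**: pulling a class
  back along `φ : G' →* G` kills it iff it restricts to zero on the image subgroup `φ(G')`; this is
  the bridge between "restriction to the image of `π₁(B ∖ Δ) → π₁(P ∖ Δ)`" (the tree's local
  subgroups) and "pull-back to `H¹(B ∖ Δ, 𝕍) = H¹(π₁(B ∖ Δ), V)`" (BFNP's germ `σ_p`).

All statements are about the existing definitions; nothing is redefined. No named facts.

## References

* [HatcherAT2002] A. Hatcher, Algebraic Topology (2002), §1.1 Prop. 1.5 (change of base point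
  `β_h`), §1.1 "induced homomorphisms".
* [Schnell2010] C. Schnell, Primitive cohomology and the tube mapping, Math. Z. 268 (2010), §3
  (the restriction maps), §9.
* [BrosnanFangNiePearlstein2009] P. Brosnan, H. Fang, Z. Nie, G. Pearlstein, Singularities of
  admissible normal functions, Invent. Math. 177 (2009), §1 eq. (1) (`σ_s(ν) ∈ colim_U H¹(U ∩ S, 𝕍)`).
-/

noncomputable section

open CategoryTheory groupCohomology
open scoped Pointwise

universe u v

namespace Literature.AlgebraicGeometry.HodgeTheory

/-! ### Inflation is injective on `H¹` -/

section Inflation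

variable {k G G' : Type u} [CommRing k] [Group G] [Group G'] (A : Rep k G) (φ : G' →* G)

/-- **Inflation–restriction in degree one, kernel form.** For a group homomorphism `φ : G' → G`
and a `G`-representation `A`, a class `ξ ∈ H¹(G, A)` pulls back to zero in `H¹(G', φ^*A)` iff it
restricts to zero on the image subgroup `φ(G') ≤ G`: if `ξ = [f]` and `f ∘ φ` is the coboundary of
`x`, then `f(φ g') = φ(g')·x - x`, so `f|_{φ(G')}` is the coboundary of the same `x`. For `φ` the map
`π₁(B ∖ Δ, s') → π₁(P ∖ Δ, s)` this identifies "restriction of `ξ` to the local fundamental group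
(an image subgroup) vanishes" with "the pull-back of `ξ` to `H¹(B ∖ Δ, 𝕍)` vanishes". [folklore] -/
theorem map_eq_zero_iff_mem_H1resKer_range (ξ : H1 A) :
    (groupCohomology.map φ (𝟙 (Rep.res φ A)) 1) ξ = 0 ↔ ξ ∈ H1resKer A φ.range := by
  induction ξ using H1_induction_on with
  | h f =>
    rw [H1resKer_mk_iff]
    change (H1π A ≫ groupCohomology.map φ (𝟙 _) 1) f = 0 ↔ _
    rw [H1π_comp_map, ModuleCat.comp_apply, H1π_eq_zero_iff, coe_mapCocycles₁,
      mem_coboundaries₁_iff_exists]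
    constructor
    · rintro ⟨x, hx⟩
      refine ⟨x, ?_⟩
      rintro _ ⟨g', rfl⟩
      simpa using hx g'
    · rintro ⟨x, hx⟩
      exact ⟨x, fun g' => by simpa using hx (φ g') ⟨g', rfl⟩⟩

end Inflation

/-! ### Change of base point on classes of loops -/

section Loops

variable {S : Type u} [TopologicalSpace S]

/-- **Change of base point on the class of a loop**: transporting `[ℓ] ∈ π₁(S, x)` along a path
`δ` from `x` to `y` gives `[δ̄ · ℓ · δ] ∈ π₁(S, y)` (Hatcher's `β_δ`; here by `rfl`).
[cite: HatcherAT2002, §1.1 Prop. 1.5] -/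
theorem fundamentalGroupMulEquivOfPath_fromPath {x y : S} (δ : Path x y) (ℓ : Path x x) :
    FundamentalGroup.fundamentalGroupMulEquivOfPath δ
        (FundamentalGroup.fromPath (Path.Homotopic.Quotient.mk ℓ)) =
      FundamentalGroup.fromPath (Path.Homotopic.Quotient.mk (δ.symm.trans (ℓ.trans δ))) :=
  rfl

/-- **Inner automorphisms on classes of loops**: `[g] [ℓ] [g]⁻¹ = [ḡ · ℓ · g]` in `π₁(S, x)` (with
Mathlib's convention `p * q = q.trans p`). [cite: HatcherAT2002, §1.1 Prop. 1.5] -/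
theorem conj_fromPath {x : S} (g ℓ : Path x x) :
    MulAut.conj (FundamentalGroup.fromPath (Path.Homotopic.Quotient.mk g))
        (FundamentalGroup.fromPath (Path.Homotopic.Quotient.mk ℓ)) =
      FundamentalGroup.fromPath (Path.Homotopic.Quotient.mk (g.symm.trans (ℓ.trans g))) := by
  rw [MulAut.conj_apply, FundamentalGroup.mul_def, FundamentalGroup.mul_def,
    FundamentalGroup.inv_def]
  rfl

/-- In the fundamental groupoid, the class of a concatenation is the composite (`rfl`). [folklore] -/
theorem fromPath_mk_trans {x y z : S} (p : Path x y) (q : Path y z) :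
    FundamentalGroupoid.fromPath (Path.Homotopic.Quotient.mk (p.trans q)) =
      FundamentalGroupoid.fromPath (Path.Homotopic.Quotient.mk p) ≫
        FundamentalGroupoid.fromPath (Path.Homotopic.Quotient.mk q) :=
  rfl

/-- In the fundamental groupoid, the class of the reversed path is the inverse. [folklore] -/
theorem fromPath_mk_symm {x y : S} (p : Path x y) :
    FundamentalGroupoid.fromPath (Path.Homotopic.Quotient.mk p.symm) =
      inv (FundamentalGroupoid.fromPath (Path.Homotopic.Quotient.mk p)) := by
  rw [← Groupoid.inv_eq_inv]
  rfl

/-- An element of `π₁(S, x)` built from a class of loops, viewed as an arrow (`rfl`). [folklore] -/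
theorem toArrow_fromPath {x : S} (q : Path.Homotopic.Quotient x x) :
    FundamentalGroup.toArrow (FundamentalGroup.fromPath q) = FundamentalGroupoid.fromPath q :=
  rfl

/-- The change-of-base-point isomorphism as conjugation by the arrow `[γ]` in the fundamental
groupoid: `β_γ(q) = [γ]⁻¹ ≫ q ≫ [γ]`. [cite: HatcherAT2002, §1.1 Prop. 1.5] -/
theorem toArrow_fundamentalGroupMulEquivOfPath {a b : S} (γ : Path a b) (q : FundamentalGroup S a) :
    FundamentalGroup.toArrow (FundamentalGroup.fundamentalGroupMulEquivOfPath γ q) =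
      inv (FundamentalGroupoid.fromPath (Path.Homotopic.Quotient.mk γ)) ≫ FundamentalGroup.toArrow q ≫
        FundamentalGroupoid.fromPath (Path.Homotopic.Quotient.mk γ) := by
  rw [← Groupoid.inv_eq_inv]
  rfl

/-- Inner automorphisms of `π₁(S, x)` as conjugation in the fundamental groupoid:
`g q g⁻¹ = g⁻¹ ≫ q ≫ g` (Mathlib's `p * q = q ≫ p`). [folklore] -/
theorem toArrow_conj {x : S} (g q : FundamentalGroup S x) :
    FundamentalGroup.toArrow (MulAut.conj g q) =
      inv (FundamentalGroup.toArrow g) ≫ FundamentalGroup.toArrow q ≫ FundamentalGroup.toArrow g := by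
  rw [← Groupoid.inv_eq_inv, MulAut.conj_apply, FundamentalGroup.mul_def, FundamentalGroup.mul_def,
    FundamentalGroup.inv_def]
  rfl

/-- `FundamentalGroup.toArrow` is injective (it is the identity on underlying terms). [folklore] -/
theorem toArrow_injective {x : S} :
    Function.Injective (FundamentalGroup.toArrow (X := S) (x := x)) :=
  fun _ _ h => h

/-- **Compatibility of base changes**: conjugating `β_{γ'}(q)` by the class of the loop
`γ̄' · δ · γ''` gives `β_{γ''}(β_δ(q))` — the identity behind "local subgroups are well defined up
to conjugacy". [cite: HatcherAT2002, §1.1 Prop. 1.5] -/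
theorem conj_fundamentalGroupMulEquivOfPath {s s' s'' : S} (δ : Path s' s'') (γ' : Path s' s)
    (γ'' : Path s'' s) (q : FundamentalGroup S s') :
    MulAut.conj (FundamentalGroup.fromPath
        (Path.Homotopic.Quotient.mk (γ'.symm.trans (δ.trans γ''))))
        (FundamentalGroup.fundamentalGroupMulEquivOfPath γ' q) =
      FundamentalGroup.fundamentalGroupMulEquivOfPath γ''
        (FundamentalGroup.fundamentalGroupMulEquivOfPath δ q) := by
  apply toArrow_injective
  rw [toArrow_conj, toArrow_fundamentalGroupMulEquivOfPath, toArrow_fundamentalGroupMulEquivOfPath,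
    toArrow_fundamentalGroupMulEquivOfPath, toArrow_fromPath]
  simp only [fromPath_mk_trans, fromPath_mk_symm, IsIso.inv_comp, IsIso.inv_inv, Category.assoc,
    IsIso.hom_inv_id_assoc]

/-- `β_δ[δ · m · δ̄] = [m]`: transporting back a loop that was transported forward. [folklore] -/
theorem fundamentalGroupMulEquivOfPath_fromPath_trans_trans_symm {x y : S} (δ : Path x y)
    (m : Path y y) :
    FundamentalGroup.fundamentalGroupMulEquivOfPath δ
        (FundamentalGroup.fromPath (Path.Homotopic.Quotient.mk (δ.trans (m.trans δ.symm)))) =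
      FundamentalGroup.fromPath (Path.Homotopic.Quotient.mk m) := by
  apply toArrow_injective
  rw [toArrow_fundamentalGroupMulEquivOfPath, toArrow_fromPath, toArrow_fromPath]
  simp only [fromPath_mk_trans, fromPath_mk_symm, Category.assoc, IsIso.inv_hom_id_assoc,
    IsIso.inv_hom_id, Category.comp_id]

/-- Ranges of the conjugated loops used below stay in `W`. [folklore] -/
theorem range_symm_trans_trans_subset {W : Set S} {x y : S} (δ : Path x y) (ℓ : Path x x)
    (hδ : Set.range δ ⊆ W) (hℓ : Set.range ℓ ⊆ W) : Set.range (δ.symm.trans (ℓ.trans δ)) ⊆ W := by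
  rw [Path.trans_range, Path.trans_range, Path.symm_range]
  exact Set.union_subset hδ (Set.union_subset hℓ hδ)

/-- **Transport inside `W` preserves the loops-in-`W` subgroups**: for a path `δ` from `x` to `y`
with image in `W`, the change-of-base-point isomorphism along `δ` carries `loopSubgroup W x` onto
`loopSubgroup W y` (`[ℓ] ↦ [δ̄ · ℓ · δ]`, and `δ̄ · ℓ · δ` stays in `W`).
[cite: HatcherAT2002, §1.1 Prop. 1.5] -/
theorem loopSubgroup_map_fundamentalGroupMulEquivOfPath {W : Set S} {x y : S} (hx : x ∈ W)
    (hy : y ∈ W) (δ : Path x y) (hδ : Set.range δ ⊆ W) :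
    (loopSubgroup W x hx).map (FundamentalGroup.fundamentalGroupMulEquivOfPath δ).toMonoidHom =
      loopSubgroup W y hy := by
  refine le_antisymm ?_ ?_
  · rintro _ ⟨p, ⟨ℓ, hℓ, rfl⟩, rfl⟩
    exact ⟨δ.symm.trans (ℓ.trans δ), range_symm_trans_trans_subset δ ℓ hδ hℓ,
      (fundamentalGroupMulEquivOfPath_fromPath δ ℓ).symm⟩
  · rintro _ ⟨ℓ, hℓ, rfl⟩
    refine ⟨FundamentalGroup.fromPath (Path.Homotopic.Quotient.mk (δ.trans (ℓ.trans δ.symm))),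
      ⟨δ.trans (ℓ.trans δ.symm), ?_, rfl⟩, ?_⟩
    · simpa only [Path.symm_symm] using range_symm_trans_trans_subset δ.symm ℓ
        (by rwa [Path.symm_range]) hℓ
    · rw [MulEquiv.coe_toMonoidHom, fundamentalGroupMulEquivOfPath_fromPath_trans_trans_symm]

variable {T : Type v} [TopologicalSpace T] (ι : C(S, T)) (s : S)

/-- **Local subgroups at one piece are conjugate.** If the view points `s'`, `s''` (with
`ι s', ι s'' ∈ N`) are joined by a path `δ` inside `ι⁻¹ N`, then for any paths `γ'`, `γ''` to the
base point the local subgroups `localSubgroup ι s N hs'' γ''` and `localSubgroup ι s N hs' γ'` are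
conjugate in `π₁(S, s)`, by the class of the loop `γ̄' · δ · γ''`. Hence "the local fundamental
group at `t₀`, well defined up to conjugacy". [cite: HatcherAT2002, §1.1 Prop. 1.5] -/
theorem localSubgroup_eq_conj_smul {N : Set T} {s' s'' : S} (hs' : ι s' ∈ N) (hs'' : ι s'' ∈ N)
    (δ : Path s' s'') (hδ : Set.range δ ⊆ ι ⁻¹' N) (γ' : Path s' s) (γ'' : Path s'' s) :
    localSubgroup ι s N hs'' γ'' =
      MulAut.conj (FundamentalGroup.fromPath
          (Path.Homotopic.Quotient.mk (γ'.symm.trans (δ.trans γ'')))) •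
        localSubgroup ι s N hs' γ' := by
  refine le_antisymm ?_ ?_
  · rintro _ ⟨_, ⟨ℓ, hℓ, rfl⟩, rfl⟩
    refine Subgroup.mem_smul_pointwise_iff_exists _ _ _ |>.2
      ⟨FundamentalGroup.fundamentalGroupMulEquivOfPath γ'
          (FundamentalGroup.fromPath (Path.Homotopic.Quotient.mk (δ.trans (ℓ.trans δ.symm)))),
        ⟨_, ⟨δ.trans (ℓ.trans δ.symm), ?_, rfl⟩, rfl⟩, ?_⟩
    · simpa only [Path.symm_symm] using range_symm_trans_trans_subset δ.symm ℓ
        (by rwa [Path.symm_range]) hℓ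
    · rw [MulAut.smul_def, conj_fundamentalGroupMulEquivOfPath,
        fundamentalGroupMulEquivOfPath_fromPath_trans_trans_symm]
      rfl
  · intro g hg
    obtain ⟨m, ⟨_, ⟨ℓ, hℓ, rfl⟩, rfl⟩, rfl⟩ := (Subgroup.mem_smul_pointwise_iff_exists _ _ _).1 hg
    refine ⟨FundamentalGroup.fundamentalGroupMulEquivOfPath δ
        (FundamentalGroup.fromPath (Path.Homotopic.Quotient.mk ℓ)), ?_, ?_⟩
    · rw [fundamentalGroupMulEquivOfPath_fromPath]
      exact ⟨δ.symm.trans (ℓ.trans δ), range_symm_trans_trans_subset δ ℓ hδ hℓ, rfl⟩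
    · rw [MulAut.smul_def, MulEquiv.coe_toMonoidHom, MulEquiv.coe_toMonoidHom,
        conj_fundamentalGroupMulEquivOfPath]

end Loops

/-! ### Local kernels from one view point -/

section LocalKernels

open _root_.Topology Filter

variable {k S : Type u} [CommRing k] [TopologicalSpace S] {T : Type v} [TopologicalSpace T]
  (ι : C(S, T)) (s : S)

/-- Restriction kernels of local subgroups at one piece `N` do not depend on the view point within
a path component of `ι⁻¹ N` (nor on the path to the base point): conjugate subgroups have the same
restriction kernel (`H1resKer_conj_smul`). Stated for every representation `A` of `π₁(S, s)`.
[cite: HatcherAT2002, §1.1 Prop. 1.5] -/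
theorem H1resKer_localSubgroup_eq_of_joinedIn (A : Rep k (FundamentalGroup S s)) {N : Set T}
    {s' s'' : S} (hs' : ι s' ∈ N) (hs'' : ι s'' ∈ N) (h : JoinedIn (ι ⁻¹' N) s' s'')
    (γ' : Path s' s) (γ'' : Path s'' s) :
    H1resKer A (localSubgroup ι s N hs'' γ'') = H1resKer A (localSubgroup ι s N hs' γ') := by
  rw [localSubgroup_eq_conj_smul ι s hs' hs'' h.somePath (Set.range_subset_iff.2 h.somePath_mem)
    γ' γ'', H1resKer_conj_smul]

variable (V : Motives.LocalSystem k S)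

/-- **One view point suffices.** If `ι⁻¹ N` is path connected, the local kernel at `N` (defined
with all view points and all paths) is the restriction kernel of any single local subgroup
`localSubgroup ι s N hs' γ` — the route's `ker (H¹(G, V_s) → H¹(G_{t₀}, V_s))` for `N` a small ball
around `t₀ ∈ Δ` with `B ∖ Δ` connected. [cite: BrosnanFangNiePearlstein2009, §1 eq. (1)] -/
theorem localKernelOn_eq_H1resKer {N : Set T} (hN : IsPathConnected (ι ⁻¹' N)) {s' : S}
    (hs' : ι s' ∈ N) (γ : Path s' s) :
    localKernelOn ι V s N = H1resKer (monodromyRepObj V s) (localSubgroup ι s N hs' γ) := by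
  refine le_antisymm (fun ξ hξ => (mem_localKernelOn_iff ι V s N ξ).1 hξ s' hs' γ) fun ξ hξ => ?_
  rw [mem_localKernelOn_iff]
  intro s'' hs'' γ''
  rwa [H1resKer_localSubgroup_eq_of_joinedIn ι s (monodromyRepObj V s) hs' hs''
    (hN.joinedIn s' hs' s'' hs'') γ γ'']

/-- **The local kernel on a neighbourhood basis.** For any basis `(N_i)_{p i}` of `𝓝 t₀` (e.g.
small balls), `ξ` lies in the local kernel at `t₀` iff it lies in `localKernelOn ι V s (N_i)` for
some basic `N_i` — the kernel of the map to `colim_{B ∋ t₀}` computed along the basis.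
[cite: BrosnanFangNiePearlstein2009, §1 eq. (1)] -/
theorem mem_localKernel_iff_of_hasBasis {ι' : Sort*} {p : ι' → Prop} {Nb : ι' → Set T} {t₀ : T}
    (hB : (𝓝 t₀).HasBasis p Nb) (ξ : H1 (monodromyRepObj V s)) :
    ξ ∈ localKernel ι V s t₀ ↔ ∃ i, p i ∧ ξ ∈ localKernelOn ι V s (Nb i) := by
  rw [localKernel, mem_trivialNear_iff]
  constructor
  · rintro ⟨N, hN, hξ⟩
    obtain ⟨i, hi, hiN⟩ := hB.mem_iff.1 hN
    exact ⟨i, hi, localKernelOn_antitone ι V s hiN hξ⟩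
  · rintro ⟨i, hi, hξ⟩
    exact ⟨Nb i, hB.mem_of_mem hi, hξ⟩

/-- **Stable local kernels.** If along a neighbourhood basis of `t₀` the kernels
`localKernelOn ι V s (N_i)` are all equal to one submodule `K` (as happens when the local
fundamental groups of small balls stabilise up to conjugacy — Milnor's conic structure), then the
local kernel at `t₀` is `K`. [cite: BrosnanFangNiePearlstein2009, §1 eq. (1)] -/
theorem localKernel_eq_of_forall_eq {ι' : Sort*} {p : ι' → Prop} {Nb : ι' → Set T} {t₀ : T}
    (hB : (𝓝 t₀).HasBasis p Nb) (K : Submodule k (H1 (monodromyRepObj V s)))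
    (hK : ∀ i, p i → localKernelOn ι V s (Nb i) = K) : localKernel ι V s t₀ = K := by
  ext ξ
  rw [mem_localKernel_iff_of_hasBasis ι s V hB]
  constructor
  · rintro ⟨i, hi, hξ⟩
    rwa [hK i hi] at hξ
  · intro hξ
    obtain ⟨i, hi⟩ := hB.ex_mem
    exact ⟨i, hi, by rwa [hK i hi]⟩

end LocalKernels

end Literature.AlgebraicGeometry.HodgeTheory

end
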